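import Summits.Ventures.PercRepro.MSTightMerge

/-!
# (R*-M) proper reduced to the one-outside-vertex case (Addendum 39, the proof modulo Theorem B)

Dossier proofs/MINE1-theoremS.md, Addendum 39 (the proof), and proofs/MINE1-RSTARM-PROOF.md §6.
`OneVertexWitness α` is the statement of Addendum 38 §4 (Theorem B): every instance of (R*-M)
on a ground set `insert m u` (`m ∉ u`) — all of whose members outside `u` pass through the single
vertex `m` — has a witness. **Theorem `RInst.exists_witness_of_oneVertexWitness`:** under
`OneVertexWitness α`, EVERY instance `RInst S L' T u` has a witness. The proof is the case split
of Addendum 39: a tight `T` by (F3); a singleton of `ū` in `U` directly; all members inside `u` by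
(F6); otherwise the residue case with an outside member, where the merge (MSTightMerge.lean) is an
instance on `insert m u` — its witness, given by `OneVertexWitness`, lifts to `T`.
`OneVertexWitness α` is a candidate Prop: it is never asserted here; Theorem B is the remaining
piece of the Lean chain of Theorem (R*-M) proper.
-/

namespace PercRepro.MSTight

open Finset
open scoped FinsetFamily

variable (α : Type*) [DecidableEq α] [Fintype α]

/-- **The one-outside-vertex statement (Theorem B of Addendum 38 §4), as a candidate Prop.**
Every instance of (R*-M) on a ground set `insert m u` with `m ∉ u` has a witness. -/
def OneVertexWitness : Prop :=
  ∀ (u : Finset α) (L' T : Finset (Finset α)) (m : α), m ∉ u →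
    RInst (insert m u) L' T u → ∃ y ∈ T, y ∈ L'

variable {α}

namespace RInst

variable {S u : Finset α} {L' T : Finset (Finset α)}

/-- **(R*-M) proper, modulo the one-outside-vertex case.** Under `OneVertexWitness α`, every
instance has a witness. -/
theorem exists_witness_of_oneVertexWitness (hOV : OneVertexWitness α) (h : RInst S L' T u) :
    ∃ y ∈ T, y ∈ L' := by
  -- the tight case: (F3)
  by_cases hF : Tight T
  · obtain ⟨y, hy, -, hyL⟩ := h.exists_witness_of_tight hF
    exact ⟨y, hy, hyL⟩
  -- a singleton of `ū` in `U`
  by_cases hsing : ∃ m ∈ S \ u, S.erase m ∈ L'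
  · obtain ⟨m, hm, hm'⟩ := hsing
    exact h.exists_witness_of_erase_mem (mem_sdiff.1 hm).1 hm'
  push Not at hsing
  -- every member inside `u`: (F6)
  by_cases hTu : ∀ y ∈ T, y ⊆ u
  · exact h.exists_witness_of_forall_subset hTu
  push Not at hTu
  -- the residue case with an outside member: merge, Theorem B, lift
  obtain ⟨y, hy, hyu⟩ := id hTu
  obtain ⟨m, -, hmu⟩ := not_subset.1 hyu
  have hmerge := h.merge hF hsing hmu hTu
  exact h.exists_witness_of_merge hF hsing hmu hTu (hOV u _ _ m hmu hmerge)

end RInst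

end PercRepro.MSTight
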